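import Summits.BirchSwinnertonDyer.BirchSwinnertonDyer.Theorems.ShaPrimaryTransferFiniteShaComponentTransferSelmerCubicRSKRow
import HarnessLib

/-!
# BirchSwinnertonDyer — SEL2CUBIC door for the `checkRSK` census rows: the `K`-free row shapes

HONEST FRAMING: route `ShaPrimaryTransfer`, seat `bsd-line-spt-p1` (g30), `--supports` item T =
`FiniteShaComponentTransfer` (stmt-22356), UNCHANGED (conjecture-grade at corank ≥ 2). BSD in rank ≥ 2 is
NOT proved by any of this. THEOREMS ONLY.

The wrappers of `sha_door_of_checkRSK` (`…SelmerCubicRSKRow`) in the exact argument shapes of the census rows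
`rank_eq_of_certsRSK{,_scaled,_complSq,_plain}` (`Rank2Observatory2DescClRealKillCurveCertSRows`, `hk : killSearchS … = true`
unchanged): every such row becomes an unconditional `t₂(E) = 0 ∧ rank E(ℚ) = r` door by swapping theorem names.
[cite: Cassels1991LecturesEllipticCurves, §15] [cite: SilvermanAEC2009, Thm. X.4.2, Rem. X.4.1]
[cite: CremonaAlgorithms1997, §3.6]
-/

-- single-conjunct summit: `Summit.BirchSwinnertonDyer.BirchSwinnertonDyer.…` repeats the name by design
set_option linter.dupNamespace false

noncomputable section

open scoped Classical NumberField nonZeroDivisors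

open Literature.NumberTheory.NumberFields Literature.NumberTheory.EllipticCurves
  Literature.NumberTheory.GaloisRepresentations Polynomial Module NumberField IsDedekindDomain Ideal
open WeierstrassCurve WeierstrassCurve.Affine

namespace Summit.BirchSwinnertonDyer.BirchSwinnertonDyer.Theorems.ShaPrimaryTransferSelmerCubicCover

open Summit.BirchSwinnertonDyer.BirchSwinnertonDyer.Rank2Observatory
open Summit.BirchSwinnertonDyer.BirchSwinnertonDyer.Rank2Observatory.TwoDescCubic
open Summit.BirchSwinnertonDyer.BirchSwinnertonDyer.Rank2Observatory.TwoDescCl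
open Summit.BirchSwinnertonDyer.BirchSwinnertonDyer.Rank2Observatory.TwoDescCl.ClFieldCert
open Summit.BirchSwinnertonDyer.BirchSwinnertonDyer.Rank2Observatory.TwoDescKill
open Summit.BirchSwinnertonDyer.BirchSwinnertonDyer.Theorems.ShaPrimaryTransferSelmerCubicKill

/-! ## `K`-free wrappers (the census rows' shapes) -/

section Rows

/-- **`K`-free door shape** (model `(0, A, 0, B, C)` read over `ℚ` from `ℤ`), in the exact shape of
`rank_eq_of_certsRSK`: the row's arguments unchanged (`hk` unchanged), the theorem name swapped.
[cite: Cassels1991LecturesEllipticCurves, §15] [cite: CremonaAlgorithms1997, §3.6] -/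
theorem sha_door_of_certsRSK (r : ℕ) (G : ClFieldCertRS2) (ccr : ClCurveCertSR) (ks : List ClKillS)
    (h2 : G.check2RS = true) (hpr : G.toS2.fs.base.primeList.Forall Nat.Prime)
    (hc : checkRSK G ccr r ks = true)
    (hk : killSearchS G.toS2 ccr.cc ks = true)
    (hlow : r ≤ (((⟨0, ccr.cc.A, 0, ccr.cc.B, ccr.cc.C⟩ : WeierstrassCurve ℤ)).map (Int.castRingHom ℚ)).mordellWeilRank) :
    (((⟨0, ccr.cc.A, 0, ccr.cc.B, ccr.cc.C⟩ : WeierstrassCurve ℤ)).map (Int.castRingHom ℚ)).shaCorank 2 = 0 ∧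
      AddCommGroup.primaryComponent (((⟨0, ccr.cc.A, 0, ccr.cc.B, ccr.cc.C⟩ : WeierstrassCurve ℤ)).map (Int.castRingHom ℚ)).sha 2 = ⊥ ∧
        (((⟨0, ccr.cc.A, 0, ccr.cc.B, ccr.cc.C⟩ : WeierstrassCurve ℤ)).map (Int.castRingHom ℚ)).mordellWeilRank = r := by
  haveI : Fact (Irreducible (MonicCubic.polyQ G.toS2.fs.base.a G.toS2.fs.base.b G.toS2.fs.base.c)) :=
    ⟨G.toS2.fs.base.irreducible_of_reg (G.toS2.fs.checkReg_of_coreS (G.coreS_of_check2RS h2))⟩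
  exact sha_door_map_of_door (fun h => sha_door_of_checkRSK (K := CubicField G.toS2.fs.base.a G.toS2.fs.base.b G.toS2.fs.base.c) r G
      (CubicField.aeval_root _ _ _) (CubicField.finrank_eq _ _ _) h2 hpr ccr ks hc hk h) hlow

/-- `Δ ≠ 0` is the first clause of `checkRSK`. [folklore] -/
theorem deltaShort_ne_of_checkRSK {r : ℕ} {G : ClFieldCertRS2} {ccr : ClCurveCertSR} {ks : List ClKillS}
    (hc : checkRSK G ccr r ks = true) : deltaShort ccr.cc.A ccr.cc.B ccr.cc.C ≠ 0 := by
  simp only [checkRSK, Bool.and_eq_true, decide_eq_true_eq] at hc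
  exact hc.1.1.1.1.1.1.1.1.1.1.1.1.1.1.1.1.1.1.1

/-- **`t₂(E) = 0 ∧ rank E(ℚ) = r` for the ORIGINAL model** `(a₁, a₂, a₃, a₄, a₆)` when the records certify its
completed-square model RESCALED by `d`, in the shape of `rank_eq_of_certsRSK_scaled`.
[cite: CremonaAlgorithms1997, §3.6] [cite: SilvermanAEC2009, III.3.1(b), Thm. X.4.2] -/
theorem shaCorank_two_eq_zero_of_certsRSK_scaled (r : ℕ) (G : ClFieldCertRS2) (ccr : ClCurveCertSR) (ks : List ClKillS)
    (h2 : G.check2RS = true) (hpr : G.toS2.fs.base.primeList.Forall Nat.Prime)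
    (hc : checkRSK G ccr r ks = true)
    (hk : killSearchS G.toS2 ccr.cc ks = true)
    (a₁ a₂ a₃ a₄ a₆ d : ℤ) (hd : d ≠ 0)
    (hABC : ccr.cc.A = d ^ 2 * (a₁ ^ 2 + 4 * a₂) ∧ ccr.cc.B = d ^ 4 * (8 * (a₁ * a₃ + 2 * a₄)) ∧
      ccr.cc.C = d ^ 6 * (16 * (a₃ ^ 2 + 4 * a₆)))
    (hlow : r ≤ (((⟨a₁, a₂, a₃, a₄, a₆⟩ : WeierstrassCurve ℤ)).map (Int.castRingHom ℚ)).mordellWeilRank) :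
    (((⟨a₁, a₂, a₃, a₄, a₆⟩ : WeierstrassCurve ℤ)).map (Int.castRingHom ℚ)).shaCorank 2 = 0 ∧
      (((⟨a₁, a₂, a₃, a₄, a₆⟩ : WeierstrassCurve ℤ)).map (Int.castRingHom ℚ)).mordellWeilRank = r := by
  haveI : Fact (Irreducible (MonicCubic.polyQ G.toS2.fs.base.a G.toS2.fs.base.b G.toS2.fs.base.c)) :=
    ⟨G.toS2.fs.base.irreducible_of_reg (G.toS2.fs.checkReg_of_coreS (G.coreS_of_check2RS h2))⟩
  exact shaCorank_two_transport_scaled a₁ a₂ a₃ a₄ a₆ d hd hABC (deltaShort_ne_of_checkRSK hc)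
    (fun h => sha_door_of_checkRSK (K := CubicField G.toS2.fs.base.a G.toS2.fs.base.b G.toS2.fs.base.c) r G
      (CubicField.aeval_root _ _ _) (CubicField.finrank_eq _ _ _) h2 hpr ccr ks hc hk h) hlow

/-- The plain completed-square shape (`d = 1`), in the shape of `rank_eq_of_certsRSK_complSq`.
[cite: CremonaAlgorithms1997, §3.6] [cite: SilvermanAEC2009, Thm. X.4.2] -/
theorem shaCorank_two_eq_zero_of_certsRSK_complSq (r : ℕ) (G : ClFieldCertRS2) (ccr : ClCurveCertSR) (ks : List ClKillS)
    (h2 : G.check2RS = true) (hpr : G.toS2.fs.base.primeList.Forall Nat.Prime)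
    (hc : checkRSK G ccr r ks = true)
    (hk : killSearchS G.toS2 ccr.cc ks = true)
    (a₁ a₂ a₃ a₄ a₆ : ℤ)
    (hABC : ccr.cc.A = a₁ ^ 2 + 4 * a₂ ∧ ccr.cc.B = 8 * (a₁ * a₃ + 2 * a₄) ∧ ccr.cc.C = 16 * (a₃ ^ 2 + 4 * a₆))
    (hlow : r ≤ (((⟨a₁, a₂, a₃, a₄, a₆⟩ : WeierstrassCurve ℤ)).map (Int.castRingHom ℚ)).mordellWeilRank) :
    (((⟨a₁, a₂, a₃, a₄, a₆⟩ : WeierstrassCurve ℤ)).map (Int.castRingHom ℚ)).shaCorank 2 = 0 ∧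
      (((⟨a₁, a₂, a₃, a₄, a₆⟩ : WeierstrassCurve ℤ)).map (Int.castRingHom ℚ)).mordellWeilRank = r := by
  haveI : Fact (Irreducible (MonicCubic.polyQ G.toS2.fs.base.a G.toS2.fs.base.b G.toS2.fs.base.c)) :=
    ⟨G.toS2.fs.base.irreducible_of_reg (G.toS2.fs.checkReg_of_coreS (G.coreS_of_check2RS h2))⟩
  exact shaCorank_two_transport_complSq a₁ a₂ a₃ a₄ a₆ hABC (deltaShort_ne_of_checkRSK hc)
    (fun h => sha_door_of_checkRSK (K := CubicField G.toS2.fs.base.a G.toS2.fs.base.b G.toS2.fs.base.c) r G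
      (CubicField.aeval_root _ _ _) (CubicField.finrank_eq _ _ _) h2 hpr ccr ks hc hk h) hlow

/-- Door plumbing for a curve already given by a plain model (`a₁ = a₃ = 0`), in the shape of
`rank_eq_of_certsRSK_plain`. [cite: Cassels1991LecturesEllipticCurves, §15] -/
theorem sha_door_of_certsRSK_plain (r : ℕ) (G : ClFieldCertRS2) (ccr : ClCurveCertSR) (ks : List ClKillS)
    (h2 : G.check2RS = true) (hpr : G.toS2.fs.base.primeList.Forall Nat.Prime)
    (hc : checkRSK G ccr r ks = true)
    (hk : killSearchS G.toS2 ccr.cc ks = true)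
    (a₂ a₄ a₆ : ℤ) (hABC : ccr.cc.A = a₂ ∧ ccr.cc.B = a₄ ∧ ccr.cc.C = a₆)
    (hlow : r ≤ (((⟨0, a₂, 0, a₄, a₆⟩ : WeierstrassCurve ℤ)).map (Int.castRingHom ℚ)).mordellWeilRank) :
    (((⟨0, a₂, 0, a₄, a₆⟩ : WeierstrassCurve ℤ)).map (Int.castRingHom ℚ)).shaCorank 2 = 0 ∧
      AddCommGroup.primaryComponent (((⟨0, a₂, 0, a₄, a₆⟩ : WeierstrassCurve ℤ)).map (Int.castRingHom ℚ)).sha 2 = ⊥ ∧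
        (((⟨0, a₂, 0, a₄, a₆⟩ : WeierstrassCurve ℤ)).map (Int.castRingHom ℚ)).mordellWeilRank = r := by
  haveI : Fact (Irreducible (MonicCubic.polyQ G.toS2.fs.base.a G.toS2.fs.base.b G.toS2.fs.base.c)) :=
    ⟨G.toS2.fs.base.irreducible_of_reg (G.toS2.fs.checkReg_of_coreS (G.coreS_of_check2RS h2))⟩
  exact sha_door_transport_plain a₂ a₄ a₆ hABC
    (fun h => sha_door_of_checkRSK (K := CubicField G.toS2.fs.base.a G.toS2.fs.base.b G.toS2.fs.base.c) r G
      (CubicField.aeval_root _ _ _) (CubicField.finrank_eq _ _ _) h2 hpr ccr ks hc hk h) hlow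

end Rows

end Summit.BirchSwinnertonDyer.BirchSwinnertonDyer.Theorems.ShaPrimaryTransferSelmerCubicCover

end
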